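import Literature.NumberTheory.NumberFields.CyclotomicFieldFourValuations
import Literature.NumberTheory.QuadraticFields.SqrtNegTwoPrimary
import Literature.NumberTheory.QuadraticFields.SqrtNegTwoFieldPrimes
import Mathlib.Tactic.NormNum.Prime
import HarnessLib

/-!
# The `ℚ(√−2)` valuation table of the `5`-descent of `E_{17/2}` over `ℚ(√−2)`: three places, four Kummer values

PROOF-ONLY file (theorems only, no definition, no named fact, no `sorry`), topic `NumberTheory/EllipticCurves`; the arithmetic input
of the instance `KubertTate172SqrtNegTwoDescent` (the RANK-ONE row of the `ℚ(√−2)` twist door; companions `KubertTate1718SqrtNegTwo*`,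
`KubertTateM37152SqrtNegTwo*`).  Carrier: any number field `K` with `[K : ℚ] = 2`, `θ ∈ K`, `θ² = −2` (tree `SqrtNegTwo.FieldData θ`).

`E = E_{17/2} = [−15, −34, −68, 0, 0]` (`kubertTateFive 17 2`; rank `1`, `t₅ = 0` over `ℚ`, tree `KubertTate172ShaFive`), `mn = 34 = 2·17`,
`17 = (3 + 2θ)(3 − 2θ)` SPLIT, `2 = −θ²` ramified: THREE places `v₀ = (θ)`, `v₁ = (3 + 2θ)`, `v₂ = (3 − 2θ)` (`exists_places`).  Kummer values
`f_T = xy − 2x² + 4y`: `−T = (0, 68) ↦ 272`, `P₁ = (3910, 274550) ↦ 1044012500 = 2²·5⁵·17⁴`, the `K`-point `R₁ = (−153/4, (−2023 + 1156θ)/8)`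
(from the rational point `u = −153/4` of the twist `−2Y² = g(u)`) `↦ (183515 − 158372θ)/32`, base `2T = (34, 578) ↦ 19652`.
Their `log`-valuations (`log v = -ord`; `32 = −θ¹⁰`):

  `log = [[-8, -1, -1], [-4, -4, -4], [10, -2, -3]]`, base `[-4, -3, -3]`,

certified by explicit factorisations in `ℤ[√−2]` (`decide`).  The `K`-row differs at `v₁ ≠ v₂` (`ord 2` vs `3`).  Instrument for
stmt-BirchSwinnertonDyer-22356 («T»); BSD is not proved by this.

## References

* [SilvermanAEC2009] J. H. Silverman, *AEC*, 2nd ed., Exercise 10.1(c), Thm. X.1.1.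
* [IrelandRosen1990] K. Ireland, M. Rosen, *A Classical Introduction to Modern Number Theory*, 2nd ed., Ch. 13 §1.
-/

noncomputable section

open scoped NumberField
open NumberField Ideal IsDedekindDomain Literature.NumberTheory.NumberFields Literature.NumberTheory.QuadraticFields

namespace Literature.NumberTheory.EllipticCurves

namespace KubertTate172SqrtNegTwoDescent

variable {K : Type} [Field K] [NumberField K] {θ : K}

/-! ## §1 The three places of `K` above `mn = 2·17` -/

/-- An element of `ℤ[√−2]` of prime norm gives a prime element of `𝓞 K`. [cite: IrelandRosen1990, Ch. 13 §1] -/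
private theorem prime_ringEquiv (hK : SqrtNegTwo.FieldData θ) {z : ℤ√(-2)} {p : ℕ} (hp : p.Prime) (hz : z.norm = p) :
    Prime (hK.ringEquiv z) :=
  (MulEquiv.prime_iff hK.ringEquiv.toMulEquiv).mpr (SqrtNegTwoPrimary.prime_of_norm_eq_prime hp hz)

/-- **The places `(θ)`, `(3 + 2θ)`, `(3 − 2θ)` of `K = ℚ(√−2)`** (prime elements of norms `2, 17, 17`). [cite: IrelandRosen1990, Ch. 13 §1] -/
theorem exists_places (hK : SqrtNegTwo.FieldData θ) :
    ∃ v₀ v₁ v₂ : HeightOneSpectrum (𝓞 K),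
      v₀.asIdeal = span {hK.ringEquiv ⟨0, 1⟩} ∧ v₁.asIdeal = span {hK.ringEquiv ⟨3, 2⟩} ∧ v₂.asIdeal = span {hK.ringEquiv ⟨3, -2⟩} := by
  obtain ⟨v₀, h₀⟩ := exists_asIdeal_eq_span (prime_ringEquiv hK (p := 2) (by norm_num) (by decide) : Prime (hK.ringEquiv ⟨0, 1⟩))
  obtain ⟨v₁, h₁⟩ := exists_asIdeal_eq_span (prime_ringEquiv hK (p := 17) (by norm_num) (by decide) : Prime (hK.ringEquiv ⟨3, 2⟩))
  obtain ⟨v₂, h₂⟩ := exists_asIdeal_eq_span (prime_ringEquiv hK (p := 17) (by norm_num) (by decide) : Prime (hK.ringEquiv ⟨3, -2⟩))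
  exact ⟨v₀, v₁, v₂, h₀, h₁, h₂⟩

/-- The three generators are prime elements of `𝓞 K`. [cite: IrelandRosen1990, Ch. 13 §1] -/
theorem prime_gens (hK : SqrtNegTwo.FieldData θ) :
    Prime (hK.ringEquiv ⟨0, 1⟩) ∧ Prime (hK.ringEquiv ⟨3, 2⟩) ∧ Prime (hK.ringEquiv ⟨3, -2⟩) :=
  ⟨prime_ringEquiv hK (p := 2) (by norm_num) (by decide), prime_ringEquiv hK (p := 17) (by norm_num) (by decide),
    prime_ringEquiv hK (p := 17) (by norm_num) (by decide)⟩

/-! ## §2 The valuation table -/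

section Table

variable (hK : SqrtNegTwo.FieldData θ) {v₀ v₁ v₂ : HeightOneSpectrum (𝓞 K)}
  (hv₀ : v₀.asIdeal = span {hK.ringEquiv ⟨0, 1⟩}) (hv₁ : v₁.asIdeal = span {hK.ringEquiv ⟨3, 2⟩})
  (hv₂ : v₂.asIdeal = span {hK.ringEquiv ⟨3, -2⟩})

include hv₀ hv₁ hv₂

/-- The rational primes `2, 17, 17` lie in the three places (`2 = θ·(−θ)`, `17 = (3 + 2θ)(3 − 2θ)`). [cite: IrelandRosen1990, Ch. 13 §1] -/
theorem natCast_mem_places :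
    ((2 : ℕ) : 𝓞 K) ∈ v₀.asIdeal ∧ ((17 : ℕ) : 𝓞 K) ∈ v₁.asIdeal ∧ ((17 : ℕ) : 𝓞 K) ∈ v₂.asIdeal := by
  refine ⟨?_, ?_, ?_⟩
  · rw [hv₀, mem_span_singleton]
    exact ⟨hK.ringEquiv ⟨0, -1⟩, by
      rw [← map_mul, show ((2 : ℕ) : 𝓞 K) = ((2 : ℤ) : 𝓞 K) by norm_cast, ← hK.ringEquiv_intCast]
      exact congrArg hK.ringEquiv (by decide)⟩
  · rw [hv₁, mem_span_singleton]
    exact ⟨hK.ringEquiv ⟨3, -2⟩, by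
      rw [← map_mul, show ((17 : ℕ) : 𝓞 K) = ((17 : ℤ) : 𝓞 K) by norm_cast, ← hK.ringEquiv_intCast]
      exact congrArg hK.ringEquiv (by decide)⟩
  · rw [hv₂, mem_span_singleton]
    exact ⟨hK.ringEquiv ⟨3, 2⟩, by
      rw [← map_mul, show ((17 : ℕ) : 𝓞 K) = ((17 : ℤ) : 𝓞 K) by norm_cast, ← hK.ringEquiv_intCast]
      exact congrArg hK.ringEquiv (by decide)⟩


/-- **The orders of the three Kummer numerators at the three places**: `ord_{v_j}` of `272`, `1044012500`, `183515 − 158372θ` (`32·f_T(R₁)`):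
`[[8, 1, 1], [4, 4, 4], [0, 2, 3]]` (read as `log v = -ord`). [cite: SilvermanAEC2009, Exercise 10.1(c)] -/
theorem log_valuation_numerators : ∀ i j : Fin 3,
    WithZero.log ((![v₀, v₁, v₂] j).valuation K
      ((![(hK.ringEquiv ⟨272, 0⟩ : 𝓞 K), (hK.ringEquiv ⟨1044012500, 0⟩ : 𝓞 K), (hK.ringEquiv ⟨183515, -158372⟩ : 𝓞 K)] i : 𝓞 K) : K)) =
      -((![![8, 1, 1], ![4, 4, 4], ![0, 2, 3]] : Fin 3 → Fin 3 → ℕ) i j : ℤ) := by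
  obtain ⟨hℓ₀, hℓ₁, hℓ₂⟩ := natCast_mem_places hK hv₀ hv₁ hv₂
  have hπ₀ : hK.ringEquiv ⟨0, 1⟩ ∈ v₀.asIdeal := by rw [hv₀]; exact mem_span_singleton_self _
  have hπ₁ : hK.ringEquiv ⟨3, 2⟩ ∈ v₁.asIdeal := by rw [hv₁]; exact mem_span_singleton_self _
  have hπ₂ : hK.ringEquiv ⟨3, -2⟩ ∈ v₂.asIdeal := by rw [hv₂]; exact mem_span_singleton_self _

  have c00 : WithZero.log (v₀.valuation K ((hK.ringEquiv ⟨272, 0⟩ : 𝓞 K) : K)) = -8 := by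
    rw [log_valuation_eq_neg_of_eq_pow_mul hv₀ 8 (y := hK.ringEquiv ⟨17, 0⟩)
      (by rw [← map_pow, ← map_mul]; exact congrArg hK.ringEquiv (by decide))
      (not_mem_of_eq_mul_add_intCast (ℓ := 2) (by norm_num) hℓ₀ hπ₀ (z := hK.ringEquiv ⟨0, -8⟩) (d := 1)
        (by rw [← map_mul, ← hK.ringEquiv_intCast, ← map_add]; exact congrArg hK.ringEquiv (by decide)) (by norm_num))]
    norm_num
  have c01 : WithZero.log (v₁.valuation K ((hK.ringEquiv ⟨272, 0⟩ : 𝓞 K) : K)) = -1 := by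
    rw [log_valuation_eq_neg_of_eq_pow_mul hv₁ 1 (y := hK.ringEquiv ⟨48, -32⟩)
      (by rw [← map_pow, ← map_mul]; exact congrArg hK.ringEquiv (by decide))
      (not_mem_of_eq_mul_add_intCast (ℓ := 17) (by norm_num) hℓ₁ hπ₁ (z := hK.ringEquiv ⟨-1, -10⟩) (d := 11)
        (by rw [← map_mul, ← hK.ringEquiv_intCast, ← map_add]; exact congrArg hK.ringEquiv (by decide)) (by norm_num))]
    norm_num
  have c02 : WithZero.log (v₂.valuation K ((hK.ringEquiv ⟨272, 0⟩ : 𝓞 K) : K)) = -1 := by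
    rw [log_valuation_eq_neg_of_eq_pow_mul hv₂ 1 (y := hK.ringEquiv ⟨48, 32⟩)
      (by rw [← map_pow, ← map_mul]; exact congrArg hK.ringEquiv (by decide))
      (not_mem_of_eq_mul_add_intCast (ℓ := 17) (by norm_num) hℓ₂ hπ₂ (z := hK.ringEquiv ⟨-1, 10⟩) (d := 11)
        (by rw [← map_mul, ← hK.ringEquiv_intCast, ← map_add]; exact congrArg hK.ringEquiv (by decide)) (by norm_num))]
    norm_num
  have c10 : WithZero.log (v₀.valuation K ((hK.ringEquiv ⟨1044012500, 0⟩ : 𝓞 K) : K)) = -4 := by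
    rw [log_valuation_eq_neg_of_eq_pow_mul hv₀ 4 (y := hK.ringEquiv ⟨261003125, 0⟩)
      (by rw [← map_pow, ← map_mul]; exact congrArg hK.ringEquiv (by decide))
      (not_mem_of_eq_mul_add_intCast (ℓ := 2) (by norm_num) hℓ₀ hπ₀ (z := hK.ringEquiv ⟨0, -130501562⟩) (d := 1)
        (by rw [← map_mul, ← hK.ringEquiv_intCast, ← map_add]; exact congrArg hK.ringEquiv (by decide)) (by norm_num))]
    norm_num
  have c11 : WithZero.log (v₁.valuation K ((hK.ringEquiv ⟨1044012500, 0⟩ : 𝓞 K) : K)) = -4 := by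
    rw [log_valuation_eq_neg_of_eq_pow_mul hv₁ 4 (y := hK.ringEquiv ⟨-3587500, -300000⟩)
      (by rw [← map_pow, ← map_mul]; exact congrArg hK.ringEquiv (by decide))
      (not_mem_of_eq_mul_add_intCast (ℓ := 17) (by norm_num) hℓ₁ hπ₁ (z := hK.ringEquiv ⟨-703677, 369118⟩) (d := 3)
        (by rw [← map_mul, ← hK.ringEquiv_intCast, ← map_add]; exact congrArg hK.ringEquiv (by decide)) (by norm_num))]
    norm_num
  have c12 : WithZero.log (v₂.valuation K ((hK.ringEquiv ⟨1044012500, 0⟩ : 𝓞 K) : K)) = -4 := by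
    rw [log_valuation_eq_neg_of_eq_pow_mul hv₂ 4 (y := hK.ringEquiv ⟨-3587500, 300000⟩)
      (by rw [← map_pow, ← map_mul]; exact congrArg hK.ringEquiv (by decide))
      (not_mem_of_eq_mul_add_intCast (ℓ := 17) (by norm_num) hℓ₂ hπ₂ (z := hK.ringEquiv ⟨-703677, -369118⟩) (d := 3)
        (by rw [← map_mul, ← hK.ringEquiv_intCast, ← map_add]; exact congrArg hK.ringEquiv (by decide)) (by norm_num))]
    norm_num
  have c20 : WithZero.log (v₀.valuation K ((hK.ringEquiv ⟨183515, -158372⟩ : 𝓞 K) : K)) = -0 := by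
    rw [log_valuation_eq_neg_of_eq_pow_mul hv₀ 0 (y := hK.ringEquiv ⟨183515, -158372⟩)
      (by rw [pow_zero, one_mul])
      (not_mem_of_eq_mul_add_intCast (ℓ := 2) (by norm_num) hℓ₀ hπ₀ (z := hK.ringEquiv ⟨-158372, -91757⟩) (d := 1)
        (by rw [← map_mul, ← hK.ringEquiv_intCast, ← map_add]; exact congrArg hK.ringEquiv (by decide)) (by norm_num))]
    norm_num
  have c21 : WithZero.log (v₁.valuation K ((hK.ringEquiv ⟨183515, -158372⟩ : 𝓞 K) : K)) = -2 := by
    rw [log_valuation_eq_neg_of_eq_pow_mul hv₁ 2 (y := hK.ringEquiv ⟨-12517, -8168⟩)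
      (by rw [← map_pow, ← map_mul]; exact congrArg hK.ringEquiv (by decide))
      (not_mem_of_eq_mul_add_intCast (ℓ := 17) (by norm_num) hℓ₁ hπ₁ (z := hK.ringEquiv ⟨-4132, 32⟩) (d := 7)
        (by rw [← map_mul, ← hK.ringEquiv_intCast, ← map_add]; exact congrArg hK.ringEquiv (by decide)) (by norm_num))]
    norm_num
  have c22 : WithZero.log (v₂.valuation K ((hK.ringEquiv ⟨183515, -158372⟩ : 𝓞 K) : K)) = -3 := by
    rw [log_valuation_eq_neg_of_eq_pow_mul hv₂ 3 (y := hK.ringEquiv ⟨769, 2870⟩)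
      (by rw [← map_pow, ← map_mul]; exact congrArg hK.ringEquiv (by decide))
      (not_mem_of_eq_mul_add_intCast (ℓ := 17) (by norm_num) hℓ₂ hπ₂ (z := hK.ringEquiv ⟨-541, 596⟩) (d := 8)
        (by rw [← map_mul, ← hK.ringEquiv_intCast, ← map_add]; exact congrArg hK.ringEquiv (by decide)) (by norm_num))]
    norm_num
  intro i j
  fin_cases i <;> fin_cases j
  · simpa using c00
  · simpa using c01
  · simpa using c02
  · simpa using c10
  · simpa using c11
  · simpa using c12
  · simpa using c20
  · simpa using c21
  · simpa using c22

/-- **The orders of the base value `f_T(2T) = 19652 = 2²·17³` at the three places**: `[4, 3, 3]`. [cite: SilvermanAEC2009, Exercise 10.1(c)] -/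
theorem log_valuation_base : ∀ j : Fin 3,
    WithZero.log ((![v₀, v₁, v₂] j).valuation K (((hK.ringEquiv ⟨19652, 0⟩ : 𝓞 K) : 𝓞 K) : K)) =
      -((![4, 3, 3] : Fin 3 → ℕ) j : ℤ) := by
  obtain ⟨hℓ₀, hℓ₁, hℓ₂⟩ := natCast_mem_places hK hv₀ hv₁ hv₂
  have hπ₀ : hK.ringEquiv ⟨0, 1⟩ ∈ v₀.asIdeal := by rw [hv₀]; exact mem_span_singleton_self _
  have hπ₁ : hK.ringEquiv ⟨3, 2⟩ ∈ v₁.asIdeal := by rw [hv₁]; exact mem_span_singleton_self _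
  have hπ₂ : hK.ringEquiv ⟨3, -2⟩ ∈ v₂.asIdeal := by rw [hv₂]; exact mem_span_singleton_self _

  have b00 : WithZero.log (v₀.valuation K ((hK.ringEquiv ⟨19652, 0⟩ : 𝓞 K) : K)) = -4 := by
    rw [log_valuation_eq_neg_of_eq_pow_mul hv₀ 4 (y := hK.ringEquiv ⟨4913, 0⟩)
      (by rw [← map_pow, ← map_mul]; exact congrArg hK.ringEquiv (by decide))
      (not_mem_of_eq_mul_add_intCast (ℓ := 2) (by norm_num) hℓ₀ hπ₀ (z := hK.ringEquiv ⟨0, -2456⟩) (d := 1)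
        (by rw [← map_mul, ← hK.ringEquiv_intCast, ← map_add]; exact congrArg hK.ringEquiv (by decide)) (by norm_num))]
    norm_num
  have b01 : WithZero.log (v₁.valuation K ((hK.ringEquiv ⟨19652, 0⟩ : 𝓞 K) : K)) = -3 := by
    rw [log_valuation_eq_neg_of_eq_pow_mul hv₁ 3 (y := hK.ringEquiv ⟨-180, -152⟩)
      (by rw [← map_pow, ← map_mul]; exact congrArg hK.ringEquiv (by decide))
      (not_mem_of_eq_mul_add_intCast (ℓ := 17) (by norm_num) hℓ₁ hπ₁ (z := hK.ringEquiv ⟨-70, -4⟩) (d := 14)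
        (by rw [← map_mul, ← hK.ringEquiv_intCast, ← map_add]; exact congrArg hK.ringEquiv (by decide)) (by norm_num))]
    norm_num
  have b02 : WithZero.log (v₂.valuation K ((hK.ringEquiv ⟨19652, 0⟩ : 𝓞 K) : K)) = -3 := by
    rw [log_valuation_eq_neg_of_eq_pow_mul hv₂ 3 (y := hK.ringEquiv ⟨-180, 152⟩)
      (by rw [← map_pow, ← map_mul]; exact congrArg hK.ringEquiv (by decide))
      (not_mem_of_eq_mul_add_intCast (ℓ := 17) (by norm_num) hℓ₂ hπ₂ (z := hK.ringEquiv ⟨-70, 4⟩) (d := 14)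
        (by rw [← map_mul, ← hK.ringEquiv_intCast, ← map_add]; exact congrArg hK.ringEquiv (by decide)) (by norm_num))]
    norm_num
  intro j
  fin_cases j
  · simpa using b00
  · simpa using b01
  · simpa using b02

/-- `32 = θ¹⁰ · (−1)` in `𝓞 K`: `log v₀(32) = -10`, and `32` is a unit at the places above `17`. [cite: IrelandRosen1990, Ch. 13 §1] -/
theorem log_valuation_thirtytwo : ∀ j : Fin 3,
    WithZero.log ((![v₀, v₁, v₂] j).valuation K (((32 : ℤ) : 𝓞 K) : K)) = (![-10, 0, 0] : Fin 3 → ℤ) j := by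
  obtain ⟨hℓ₀, hℓ₁, hℓ₂⟩ := natCast_mem_places hK hv₀ hv₁ hv₂
  have hπ₀ : hK.ringEquiv ⟨0, 1⟩ ∈ v₀.asIdeal := by rw [hv₀]; exact mem_span_singleton_self _
  have c0 : WithZero.log (v₀.valuation K (((32 : ℤ) : 𝓞 K) : K)) = -10 := by
    rw [log_valuation_eq_neg_of_eq_pow_mul hv₀ 10 (y := hK.ringEquiv ⟨-1, 0⟩)
      (by rw [← hK.ringEquiv_intCast, ← map_pow, ← map_mul]; exact congrArg hK.ringEquiv (by decide))
      (not_mem_of_eq_mul_add_intCast (ℓ := 2) (by norm_num) hℓ₀ hπ₀ (z := hK.ringEquiv ⟨0, 0⟩) (d := -1)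
        (by rw [← map_mul, ← hK.ringEquiv_intCast, ← map_add]; exact congrArg hK.ringEquiv (by decide)) (by norm_num))]
    norm_num
  have c1 : WithZero.log (v₁.valuation K (((32 : ℤ) : 𝓞 K) : K)) = -0 := by
    rw [log_valuation_eq_neg_of_eq_pow_mul hv₁ 0 (y := ((32 : ℤ) : 𝓞 K)) (by rw [pow_zero, one_mul])
      (intCast_not_mem_of_not_dvd (ℓ := 17) (by norm_num) hℓ₁ (by norm_num))]
    norm_num
  have c2 : WithZero.log (v₂.valuation K (((32 : ℤ) : 𝓞 K) : K)) = -0 := by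
    rw [log_valuation_eq_neg_of_eq_pow_mul hv₂ 0 (y := ((32 : ℤ) : 𝓞 K)) (by rw [pow_zero, one_mul])
      (intCast_not_mem_of_not_dvd (ℓ := 17) (by norm_num) hℓ₂ (by norm_num))]
    norm_num
  intro j
  fin_cases j
  · simpa using c0
  · simpa using c1
  · simpa using c2


/-- **The `log`-valuation table of the three Kummer VALUES** (numerator orders corrected by the denominator `32 = −θ¹⁰` of the `K`-value):
`[[-8, -1, -1], [-4, -4, -4], [10, -2, -3]]`. [cite: SilvermanAEC2009, Exercise 10.1(c)] -/
theorem log_valuation_points : ∀ i j : Fin 3,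
    WithZero.log ((![v₀, v₁, v₂] j).valuation K (![((hK.ringEquiv ⟨272, 0⟩ : 𝓞 K) : K), ((hK.ringEquiv ⟨1044012500, 0⟩ : 𝓞 K) : K), ((hK.ringEquiv ⟨183515, -158372⟩ : 𝓞 K) : K) / 32] i)) = (![![-8, -1, -1], ![-4, -4, -4], ![10, -2, -3]] : Fin 3 → Fin 3 → ℤ) i j := by
  have hnum := log_valuation_numerators hK hv₀ hv₁ hv₂
  have h32 := log_valuation_thirtytwo hK hv₀ hv₁ hv₂
  have e32 : (32 : K) = (((32 : ℤ) : 𝓞 K) : K) := by rw [NumberField.RingOfIntegers.coe_eq_algebraMap, map_intCast]; norm_num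
  have hne : ∀ (v : HeightOneSpectrum (𝓞 K)) (z : ℤ√(-2)), z ≠ 0 → v.valuation K ((hK.ringEquiv z : 𝓞 K) : K) ≠ 0 := by
    intro v z hz
    rw [Valuation.ne_zero_iff]
    intro h0
    apply hz
    have h1 : (hK.ringEquiv z : 𝓞 K) = 0 := by exact_mod_cast h0
    exact hK.ringEquiv.map_eq_zero_iff.mp h1
  have h32ne : ∀ v : HeightOneSpectrum (𝓞 K), v.valuation K (((32 : ℤ) : 𝓞 K) : K) ≠ 0 := by
    intro v
    rw [Valuation.ne_zero_iff]
    norm_num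

  have c00 : WithZero.log (v₀.valuation K ((hK.ringEquiv ⟨272, 0⟩ : 𝓞 K) : K)) = -8 := by simpa using hnum 0 0
  have c01 : WithZero.log (v₁.valuation K ((hK.ringEquiv ⟨272, 0⟩ : 𝓞 K) : K)) = -1 := by simpa using hnum 0 1
  have c02 : WithZero.log (v₂.valuation K ((hK.ringEquiv ⟨272, 0⟩ : 𝓞 K) : K)) = -1 := by simpa using hnum 0 2
  have c10 : WithZero.log (v₀.valuation K ((hK.ringEquiv ⟨1044012500, 0⟩ : 𝓞 K) : K)) = -4 := by simpa using hnum 1 0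
  have c11 : WithZero.log (v₁.valuation K ((hK.ringEquiv ⟨1044012500, 0⟩ : 𝓞 K) : K)) = -4 := by simpa using hnum 1 1
  have c12 : WithZero.log (v₂.valuation K ((hK.ringEquiv ⟨1044012500, 0⟩ : 𝓞 K) : K)) = -4 := by simpa using hnum 1 2
  have n20 : WithZero.log (v₀.valuation K ((hK.ringEquiv ⟨183515, -158372⟩ : 𝓞 K) : K)) = -0 := by simpa using hnum 2 0
  have d20 : WithZero.log (v₀.valuation K (((32 : ℤ) : 𝓞 K) : K)) = -10 := by simpa using h32 0
  have c20 : WithZero.log (v₀.valuation K (((hK.ringEquiv ⟨183515, -158372⟩ : 𝓞 K) : K) / 32)) = 10 := by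
    rw [e32, map_div₀, WithZero.log_div (hne _ _ (by decide)) (h32ne _), n20, d20]; norm_num
  have n21 : WithZero.log (v₁.valuation K ((hK.ringEquiv ⟨183515, -158372⟩ : 𝓞 K) : K)) = -2 := by simpa using hnum 2 1
  have d21 : WithZero.log (v₁.valuation K (((32 : ℤ) : 𝓞 K) : K)) = 0 := by simpa using h32 1
  have c21 : WithZero.log (v₁.valuation K (((hK.ringEquiv ⟨183515, -158372⟩ : 𝓞 K) : K) / 32)) = -2 := by
    rw [e32, map_div₀, WithZero.log_div (hne _ _ (by decide)) (h32ne _), n21, d21]; norm_num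
  have n22 : WithZero.log (v₂.valuation K ((hK.ringEquiv ⟨183515, -158372⟩ : 𝓞 K) : K)) = -3 := by simpa using hnum 2 2
  have d22 : WithZero.log (v₂.valuation K (((32 : ℤ) : 𝓞 K) : K)) = 0 := by simpa using h32 2
  have c22 : WithZero.log (v₂.valuation K (((hK.ringEquiv ⟨183515, -158372⟩ : 𝓞 K) : K) / 32)) = -3 := by
    rw [e32, map_div₀, WithZero.log_div (hne _ _ (by decide)) (h32ne _), n22, d22]; norm_num
  intro i j
  fin_cases i <;> fin_cases j
  · simpa using c00
  · simpa using c01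
  · simpa using c02
  · simpa using c10
  · simpa using c11
  · simpa using c12
  · simpa using c20
  · simpa using c21
  · simpa using c22

end Table

end KubertTate172SqrtNegTwoDescent

end Literature.NumberTheory.EllipticCurves

end
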